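import Literature.Probability.LatticeModels.CellGridSaddleSymmetry
import Literature.Probability.LatticeModels.BoxDirichlet
import HarnessLib

/-!
# The discretised domain under the quarter turn `z ↦ i z` and the reflection `z ↦ z̄`

Topic `Literature/Probability/LatticeModels`; transport infrastructure for the line
`symplectic-fermion-anchor` of the crux `SAWLoopFugacityFlow.AvoidanceLimit`
(stmt-CriticalPhenomena-10649, task W5a): a lattice estimate proved in one orientation of `ℤ²` is
moved to the other orientations by the symmetries of the square lattice, which requires the
**equivariance of the whole discretisation scheme** `Ω ↦ (Ω ∩ δℤ², Ω_δ, Ω^δ, ∂Ω_δ)` of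
`DomainDiscretisation.lean` (Chelkak–Smirnov 2012, §1.2: `meshVertices`, `meshGraph`, the largest
component `meshDomain`, the graph `discreteDomainGraph`, `meshBoundary`, `discreteArc`) under the
dihedral group `D₄` of `δℤ²`, in the form consumed by the transport of killed random walks along
`SimpleGraph.map` by lattice motions (`IsLatticeMotion`, `BoxDirichlet.lean`).

The two generators of `D₄` and their pointwise (`↔`) transport lemmas exist as *cell symmetries*
(`CellGridSaddleSymmetry.lean`): `CellSymmetry.rot` (cells `rotCell : (x₀, x₁) ↦ (-x₁, x₀)`,
plane `z ↦ i z`) and `CellSymmetry.reflect` (cells `cellReflect : (x₀, x₁) ↦ (x₀, -x₁)`, plane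
`z ↦ z̄`), with `mem_meshVertices_cell`, `meshGraph_adj_cell`, `mem_meshDomain_cell`,
`discreteDomainGraph_adj_cell`, `mem_meshBoundary_cell`, `mem_discreteArc_cell`. This file adds:

* `rotCell`, `cellReflect`, their inverses and composites are **lattice motions**
  (`isLatticeMotion_rotCell`, `isLatticeMotion_rotCell_symm`, `isLatticeMotion_cellReflect`,
  `IsLatticeMotion.comp`, `IsLatticeMotion.trans`, `isLatticeMotion_id`); the embedding formulas
  `toComplex_rotCell`, `meshPoint_rotCell : meshPoint δ (rotCell v) = i · meshPoint δ v`,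
  `toComplex_cellReflect`, `meshPoint_cellReflect`; sup-norm boxes (`abs_rotCell_sub_le_iff`);
* the **set and `SimpleGraph.map` forms** of the transport for every cell symmetry `s`
  (`CellSymmetry.meshVertices_image`, `CellSymmetry.meshGraph_eq_map`,
  `CellSymmetry.meshDomain_image`, `CellSymmetry.discreteDomainGraph_eq_map`,
  `CellSymmetry.meshBoundary_image`), specialised to the quarter turn with the plain image
  `(fun z => I * z) '' Ω` (`meshVertices_mulI`, `meshGraph_adj_mulI`, `meshGraph_mulI`,
  `mem_meshDomain_mulI`, `meshDomain_mulI`, `discreteDomainGraph_adj_mulI`,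
  `discreteDomainGraph_mulI`, `meshBoundary_mulI`, `discreteArc_mulI`) and to the reflection with
  `conj '' Ω` (`meshVertices_conj`, `meshGraph_conj`, `meshDomain_conj`, `discreteDomainGraph_conj`,
  `meshBoundary_conj`, `discreteArc_conj`; the conjugate Jordan domain `JordanDomain.conjugate` of
  `Percolation/SmirnovReflection.lean` has carrier `conjSet D.carrier = conj '' D.carrier`,
  `conjSet_eq_image`);
* the **quarter turn of a Jordan domain** `JordanDomain.mulI D = i·D`, the image Jordan domain
  `D.map (Homeomorph.mulLeft₀ I _)` of `ChordalCurveFamily.lean` (carrier `i·Ω`, boundary loop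
  `t ↦ i γ(t)`), with `mulI_carrier`, `mulI_boundary`, `mem_mulI_carrier`, `closure_mulI_carrier`,
  `frontier_mulI_carrier`, `mulI_boundary_image`, and the corollaries
  `meshDomain_mulI_carrier : (i·D)_δ = rotCell '' D_δ`,
  `discreteDomainGraph_mulI_carrier : (i·D)^δ = (D^δ).map rotCell`, `meshBoundary_mulI_carrier`,
  `discreteArc_mulI_carrier`.

Everything is folklore bookkeeping; the discretisation conventions are those of Chelkak–Smirnov
[cite: ChelkakSmirnov2012, §1.2] and Smirnov (largest component) [cite: Smirnov2001, §2].

## References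

* D. Chelkak, S. Smirnov, *Universality in the 2D Ising model and conformal invariance of
  fermionic observables*, Invent. Math. 189 (2012), §1.2. [ChelkakSmirnov2012]
* S. Smirnov, *Critical percolation in the plane*, C. R. Acad. Sci. Paris 333 (2001), §2.
  [Smirnov2001]
-/

noncomputable section

open Set Complex
open scoped ComplexConjugate

namespace Literature.Probability.LatticeModels

/-! ### Lattice motions: identity, composition, the quarter turn, the axis reflection -/

/-- The identity is a lattice motion. [folklore] -/
theorem isLatticeMotion_id : IsLatticeMotion (id : Site 2 → Site 2) :=
  ⟨Equiv.refl _, fun _ _ => rfl⟩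

/-- Lattice motions compose (the permutations of the four directions compose). [folklore] -/
theorem IsLatticeMotion.comp {σ τ : Site 2 → Site 2} (hσ : IsLatticeMotion σ)
    (hτ : IsLatticeMotion τ) : IsLatticeMotion (σ ∘ τ) := by
  obtain ⟨p, hp⟩ := hσ
  obtain ⟨q, hq⟩ := hτ
  exact ⟨q.trans p, fun x k => by simp only [Function.comp_apply, hq, hp, Equiv.trans_apply]⟩

/-- Bijective lattice motions compose: `σ.trans τ = τ ∘ σ`. [folklore] -/
theorem IsLatticeMotion.trans {σ τ : Site 2 ≃ Site 2} (hσ : IsLatticeMotion σ)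
    (hτ : IsLatticeMotion τ) : IsLatticeMotion (σ.trans τ) :=
  hτ.comp hσ

/-- The quarter turn rotates the lattice directions: `rotCell (x + e_k) = rotCell x + e_{k+1}`.
[folklore] -/
theorem rotCell_add_cornerUnit (x : Site 2) (k : Fin 4) :
    rotCell (x + cornerUnit k) = rotCell x + cornerUnit (k + 1) := by
  ext i; fin_cases i <;> fin_cases k <;> simp [cornerUnit] <;> ring

/-- **The quarter turn `(x₀, x₁) ↦ (-x₁, x₀)` is a lattice motion** (`e_k ↦ e_{k+1}`). [folklore] -/
theorem isLatticeMotion_rotCell : IsLatticeMotion rotCell :=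
  ⟨Equiv.addRight 1, rotCell_add_cornerUnit⟩

/-- The inverse quarter turn rotates the directions backwards:
`rotCell⁻¹ (x + e_k) = rotCell⁻¹ x + e_{k+3}`. [folklore] -/
theorem rotCell_symm_add_cornerUnit (x : Site 2) (k : Fin 4) :
    rotCell.symm (x + cornerUnit k) = rotCell.symm x + cornerUnit (k + 3) := by
  ext i; fin_cases i <;> fin_cases k <;> simp [cornerUnit] <;> ring

/-- The inverse quarter turn `(x₀, x₁) ↦ (x₁, -x₀)` is a lattice motion. [folklore] -/
theorem isLatticeMotion_rotCell_symm : IsLatticeMotion rotCell.symm :=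
  ⟨Equiv.addRight 3, rotCell_symm_add_cornerUnit⟩

/-- The axis reflection exchanges north and south, directions `k ↦ -k`:
`cellReflect (x + e_k) = cellReflect x + e_{-k}`. [folklore] -/
theorem cellReflect_add_cornerUnit (x : Site 2) (k : Fin 4) :
    cellReflect (x + cornerUnit k) = cellReflect x + cornerUnit (-k) := by
  rw [show -k = Equiv.swap (1 : Fin 4) 3 k by revert k; decide]
  ext i; fin_cases i <;> fin_cases k <;> simp [cornerUnit, Equiv.swap_apply_def] <;> ring

/-- **The axis reflection `(x₀, x₁) ↦ (x₀, -x₁)` is a lattice motion** (`e_k ↦ e_{-k}`). [folklore] -/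
theorem isLatticeMotion_cellReflect : IsLatticeMotion cellReflect :=
  ⟨Equiv.neg (Fin 4), cellReflect_add_cornerUnit⟩

/-- The axis reflection is an involution. [folklore] -/
@[simp] theorem cellReflect_symm : cellReflect.symm = cellReflect := rfl

/-- The quarter turn is additive. [folklore] -/
theorem rotCell_add (x y : Site 2) : rotCell (x + y) = rotCell x + rotCell y := by
  ext i; fin_cases i <;> simp [add_comm]

/-- The quarter turn commutes with subtraction. [folklore] -/
theorem rotCell_sub (x y : Site 2) : rotCell (x - y) = rotCell x - rotCell y := by
  ext i; fin_cases i <;> simp [sub_eq_add_neg, add_comm]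

/-- Sup-norm boxes are carried to sup-norm boxes by the quarter turn: the box condition about
`rotCell c` for `rotCell x` is the box condition about `c` for `x`. [folklore] -/
theorem abs_rotCell_sub_le_iff (x c : Site 2) (R : ℤ) :
    (|rotCell x 0 - rotCell c 0| ≤ R ∧ |rotCell x 1 - rotCell c 1| ≤ R) ↔
      (|x 0 - c 0| ≤ R ∧ |x 1 - c 1| ≤ R) := by
  simp only [rotCell_apply_zero, rotCell_apply_one]
  rw [show -x 1 - -c 1 = -(x 1 - c 1) by ring, abs_neg]
  exact And.comm

/-- The quarter turn of the lattice is multiplication by `i` in the plane. [folklore] -/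
@[simp] theorem toComplex_rotCell (v : Site 2) : Site.toComplex (rotCell v) = I * Site.toComplex v :=
  Complex.ext (by simp) (by simp)

/-- Mesh points under the quarter turn: `δ · rotCell v = i (δ v)`. [folklore] -/
@[simp] theorem meshPoint_rotCell (δ : ℝ) (v : Site 2) : meshPoint δ (rotCell v) = I * meshPoint δ v := by
  rw [meshPoint, meshPoint, toComplex_rotCell, mul_left_comm]

/-- The axis reflection of the lattice is complex conjugation in the plane. [folklore] -/
@[simp] theorem toComplex_cellReflect (v : Site 2) :
    Site.toComplex (cellReflect v) = conj (Site.toComplex v) :=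
  Complex.ext (by simp) (by simp)

/-- Mesh points under the axis reflection: `δ · cellReflect v = conj (δ v)`. [folklore] -/
@[simp] theorem meshPoint_cellReflect (δ : ℝ) (v : Site 2) :
    meshPoint δ (cellReflect v) = conj (meshPoint δ v) := by
  rw [meshPoint, meshPoint, toComplex_cellReflect, map_mul, Complex.conj_ofReal]

/-- The quarter turn is an automorphism of `ℤ²`. [folklore] -/
theorem zdGraph_adj_rotCell (x y : Site 2) : (zdGraph 2).Adj (rotCell x) (rotCell y) ↔ (zdGraph 2).Adj x y :=
  CellSymmetry.rot.zdGraph_adj_cell x y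

/-- The axis reflection is an automorphism of `ℤ²`. [folklore] -/
theorem zdGraph_adj_cellReflect (x y : Site 2) :
    (zdGraph 2).Adj (cellReflect x) (cellReflect y) ↔ (zdGraph 2).Adj x y :=
  CellSymmetry.reflect.zdGraph_adj_cell x y

/-! ### Set and `SimpleGraph.map` forms of the transport under a cell symmetry -/

namespace CellSymmetry

variable (s : CellSymmetry) (Ω : Set ℂ) (δ : ℝ)

/-- A set characterised pointwise through a bijection is an image. [folklore] -/
theorem eq_image_of_forall_apply_mem_iff {S T : Set (Site 2)} (e : Site 2 ≃ Site 2)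
    (h : ∀ x, e x ∈ T ↔ x ∈ S) : T = e '' S := by
  ext y
  rw [Set.mem_image_equiv, ← h, Equiv.apply_symm_apply]

/-- **Mesh vertices of the transformed domain are the transformed mesh vertices.** [folklore] -/
theorem meshVertices_image : meshVertices (s.plane '' Ω) δ = s.cell '' meshVertices Ω δ :=
  eq_image_of_forall_apply_mem_iff s.cell fun _ => s.mem_meshVertices_cell

/-- **The mesh graph of the transformed domain is the pushed-forward mesh graph.** [folklore] -/
theorem meshGraph_eq_map : meshGraph (s.plane '' Ω) δ = (meshGraph Ω δ).map s.cell.toEmbedding := by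
  rw [← SimpleGraph.comap_symm]
  ext x y
  rw [SimpleGraph.comap_adj]
  exact s.meshGraph_adj_cell_symm.symm

/-- `Ω^δ`-adjacency, read through the inverse symmetry. [folklore] -/
theorem discreteDomainGraph_adj_cell_symm {x y : Site 2} :
    (discreteDomainGraph Ω δ).Adj (s.cell.symm x) (s.cell.symm y) ↔
      (discreteDomainGraph (s.plane '' Ω) δ).Adj x y := by
  rw [← s.discreteDomainGraph_adj_cell, Equiv.apply_symm_apply, Equiv.apply_symm_apply]

/-- **The graph `Ω^δ` of the transformed domain is the pushed-forward graph**: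
`(plane Ω)^δ = (Ω^δ).map cell`. [folklore] -/
theorem discreteDomainGraph_eq_map :
    discreteDomainGraph (s.plane '' Ω) δ = (discreteDomainGraph Ω δ).map s.cell.toEmbedding := by
  rw [← SimpleGraph.comap_symm]
  ext x y
  rw [SimpleGraph.comap_adj]
  exact (s.discreteDomainGraph_adj_cell_symm Ω δ).symm

/-- **The discrete domain of the transformed domain is the transformed discrete domain**
(`image_cell_meshDomain` read from the transformed side). [folklore] -/
theorem meshDomain_image : meshDomain (s.plane '' Ω) δ = s.cell '' meshDomain Ω δ :=
  (s.image_cell_meshDomain Ω δ).symm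

/-- The discrete boundary of the transformed domain is the transformed discrete boundary. [folklore] -/
theorem meshBoundary_image : meshBoundary (s.plane '' Ω) δ = s.cell '' meshBoundary Ω δ :=
  eq_image_of_forall_apply_mem_iff s.cell fun _ => s.mem_meshBoundary_cell

end CellSymmetry

/-! ### The quarter turn `Ω ↦ i·Ω` -/

section MulI

variable (Ω : Set ℂ) (δ : ℝ)

/-- Membership in `i·Ω`: `z ∈ i·Ω ↔ -i z ∈ Ω`. [folklore] -/
theorem mem_image_mulI {Ω : Set ℂ} {z : ℂ} : z ∈ (fun w => I * w) '' Ω ↔ -I * z ∈ Ω := by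
  constructor
  · rintro ⟨w, hw, rfl⟩
    rwa [← mul_assoc, neg_mul, I_mul_I, neg_neg, one_mul]
  · exact fun h => ⟨-I * z, h, by beta_reduce; rw [← mul_assoc, mul_neg, I_mul_I, neg_neg, one_mul]⟩

/-- `closure (i·Ω) = i · closure Ω`. [folklore] -/
theorem closure_image_mulI : closure ((fun z => I * z) '' Ω) = (fun z => I * z) '' closure Ω := by
  rw [← CellSymmetry.image_rot_plane, ← CellSymmetry.image_rot_plane]
  exact CellSymmetry.rot.closure_image_plane Ω

/-- `∂(i·Ω) = i · ∂Ω`. [folklore] -/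
theorem frontier_image_mulI : frontier ((fun z => I * z) '' Ω) = (fun z => I * z) '' frontier Ω := by
  rw [← CellSymmetry.image_rot_plane, ← CellSymmetry.image_rot_plane]
  exact CellSymmetry.rot.frontier_image_plane Ω

/-- **Mesh vertices of `i·Ω` are the quarter-turned mesh vertices of `Ω`.** [folklore] -/
theorem meshVertices_mulI : meshVertices ((fun z => I * z) '' Ω) δ = rotCell '' meshVertices Ω δ := by
  rw [← CellSymmetry.image_rot_plane]
  exact CellSymmetry.rot.meshVertices_image Ω δ

/-- The mesh graph of `i·Ω` is the quarter-turned mesh graph of `Ω`. [folklore] -/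
theorem meshGraph_adj_mulI {Ω : Set ℂ} {δ : ℝ} {x y : Site 2} :
    (meshGraph ((fun z => I * z) '' Ω) δ).Adj (rotCell x) (rotCell y) ↔ (meshGraph Ω δ).Adj x y := by
  rw [← CellSymmetry.image_rot_plane]
  exact CellSymmetry.rot.meshGraph_adj_cell

/-- The mesh graph of `i·Ω` is the push-forward of the mesh graph of `Ω` along `rotCell`.
[folklore] -/
theorem meshGraph_mulI : meshGraph ((fun z => I * z) '' Ω) δ = (meshGraph Ω δ).map rotCell.toEmbedding := by
  rw [← CellSymmetry.image_rot_plane]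
  exact CellSymmetry.rot.meshGraph_eq_map Ω δ

/-- **The discrete domain of `i·Ω`**: `rotCell x ∈ (i·Ω)_δ ↔ x ∈ Ω_δ` (largest components
correspond under the graph isomorphism `rotCell`, sizes being preserved). [folklore] -/
theorem mem_meshDomain_mulI {Ω : Set ℂ} {δ : ℝ} {x : Site 2} :
    rotCell x ∈ meshDomain ((fun z => I * z) '' Ω) δ ↔ x ∈ meshDomain Ω δ := by
  rw [← CellSymmetry.image_rot_plane]
  exact CellSymmetry.rot.mem_meshDomain_cell

/-- **The discrete domain of `i·Ω` is the quarter-turned discrete domain of `Ω`**: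
`(i·Ω)_δ = rotCell '' Ω_δ`. [folklore] -/
theorem meshDomain_mulI : meshDomain ((fun z => I * z) '' Ω) δ = rotCell '' meshDomain Ω δ := by
  rw [← CellSymmetry.image_rot_plane]
  exact CellSymmetry.rot.meshDomain_image Ω δ

/-- Adjacency in `(i·Ω)^δ` is quarter-turned adjacency in `Ω^δ`. [folklore] -/
theorem discreteDomainGraph_adj_mulI {Ω : Set ℂ} {δ : ℝ} {x y : Site 2} :
    (discreteDomainGraph ((fun z => I * z) '' Ω) δ).Adj (rotCell x) (rotCell y) ↔
      (discreteDomainGraph Ω δ).Adj x y := by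
  rw [← CellSymmetry.image_rot_plane]
  exact CellSymmetry.rot.discreteDomainGraph_adj_cell

/-- **The graph `(i·Ω)^δ` is the push-forward of `Ω^δ` along `rotCell`.** [folklore] -/
theorem discreteDomainGraph_mulI :
    discreteDomainGraph ((fun z => I * z) '' Ω) δ = (discreteDomainGraph Ω δ).map rotCell.toEmbedding := by
  rw [← CellSymmetry.image_rot_plane]
  exact CellSymmetry.rot.discreteDomainGraph_eq_map Ω δ

/-- The discrete boundary of `i·Ω` is the quarter-turned discrete boundary of `Ω`. [folklore] -/
theorem meshBoundary_mulI : meshBoundary ((fun z => I * z) '' Ω) δ = rotCell '' meshBoundary Ω δ := by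
  rw [← CellSymmetry.image_rot_plane]
  exact CellSymmetry.rot.meshBoundary_image Ω δ

/-- Discrete arcs of `(i·Ω; i·A)` are the quarter-turned discrete arcs of `(Ω; A)`. [folklore] -/
theorem discreteArc_mulI (A : Set ℂ) :
    discreteArc ((fun z => I * z) '' Ω) δ ((fun z => I * z) '' A) = rotCell '' discreteArc Ω δ A := by
  rw [← CellSymmetry.image_rot_plane, ← CellSymmetry.image_rot_plane]
  exact (CellSymmetry.rot.image_cell_discreteArc Ω δ A).symm

end MulI

/-! ### The reflection `Ω ↦ conj '' Ω` -/

section Conj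

variable (Ω : Set ℂ) (δ : ℝ)

/-- Mesh vertices of `Ω̄ = conj '' Ω` are the reflected mesh vertices of `Ω`. [folklore] -/
theorem meshVertices_conj : meshVertices (conj '' Ω) δ = cellReflect '' meshVertices Ω δ := by
  rw [← CellSymmetry.image_reflect_plane]
  exact CellSymmetry.reflect.meshVertices_image Ω δ

/-- The mesh graph of `Ω̄` is the push-forward of the mesh graph of `Ω` along `cellReflect`.
[folklore] -/
theorem meshGraph_conj : meshGraph (conj '' Ω) δ = (meshGraph Ω δ).map cellReflect.toEmbedding := by
  rw [← CellSymmetry.image_reflect_plane]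
  exact CellSymmetry.reflect.meshGraph_eq_map Ω δ

/-- **The discrete domain of `Ω̄` is the reflected discrete domain of `Ω`.** [folklore] -/
theorem meshDomain_conj : meshDomain (conj '' Ω) δ = cellReflect '' meshDomain Ω δ := by
  rw [← CellSymmetry.image_reflect_plane]
  exact CellSymmetry.reflect.meshDomain_image Ω δ

/-- The graph `(Ω̄)^δ` is the push-forward of `Ω^δ` along `cellReflect`. [folklore] -/
theorem discreteDomainGraph_conj :
    discreteDomainGraph (conj '' Ω) δ = (discreteDomainGraph Ω δ).map cellReflect.toEmbedding := by
  rw [← CellSymmetry.image_reflect_plane]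
  exact CellSymmetry.reflect.discreteDomainGraph_eq_map Ω δ

/-- The discrete boundary of `Ω̄` is the reflected discrete boundary of `Ω`. [folklore] -/
theorem meshBoundary_conj : meshBoundary (conj '' Ω) δ = cellReflect '' meshBoundary Ω δ := by
  rw [← CellSymmetry.image_reflect_plane]
  exact CellSymmetry.reflect.meshBoundary_image Ω δ

/-- Discrete arcs of `(Ω̄; Ā)` are the reflected discrete arcs of `(Ω; A)`. [folklore] -/
theorem discreteArc_conj (A : Set ℂ) :
    discreteArc (conj '' Ω) δ (conj '' A) = cellReflect '' discreteArc Ω δ A := by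
  rw [← CellSymmetry.image_reflect_plane, ← CellSymmetry.image_reflect_plane]
  exact (CellSymmetry.reflect.image_cell_discreteArc Ω δ A).symm

end Conj

/-! ### The quarter turn of a Jordan domain -/

section JordanDomain

open Literature.Probability.RandomPlanarGeometry (JordanDomain)

/-- **The quarter turn `i·D` of a Jordan domain**: carrier `i·Ω = {i z | z ∈ Ω}`, boundary loop
`t ↦ i γ(t)`; the image Jordan domain under the homeomorphism `z ↦ i z` of the plane
(`JordanDomain.map`). [folklore] -/
def _root_.Literature.Probability.RandomPlanarGeometry.JordanDomain.mulI (D : JordanDomain) : JordanDomain :=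
  D.map (Homeomorph.mulLeft₀ I I_ne_zero)

variable (D : JordanDomain)

/-- The carrier of `i·D` is `i·Ω`. [folklore] -/
@[simp] theorem _root_.Literature.Probability.RandomPlanarGeometry.JordanDomain.mulI_carrier :
    D.mulI.carrier = (fun z => I * z) '' D.carrier := rfl

/-- The boundary loop of `i·D` is `t ↦ i γ(t)`. [folklore] -/
@[simp] theorem _root_.Literature.Probability.RandomPlanarGeometry.JordanDomain.mulI_boundary (t : ℝ) :
    D.mulI.boundary t = I * D.boundary t := rfl

/-- Membership in the carrier of `i·D`: `z ∈ i·Ω ↔ -i z ∈ Ω`. [folklore] -/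
theorem _root_.Literature.Probability.RandomPlanarGeometry.JordanDomain.mem_mulI_carrier {D : JordanDomain}
    {z : ℂ} : z ∈ D.mulI.carrier ↔ -I * z ∈ D.carrier :=
  mem_image_mulI

/-- `closure (i·D) = i · closure D`. [folklore] -/
theorem _root_.Literature.Probability.RandomPlanarGeometry.JordanDomain.closure_mulI_carrier :
    closure D.mulI.carrier = (fun z => I * z) '' closure D.carrier :=
  closure_image_mulI D.carrier

/-- `∂(i·D) = i · ∂D`. [folklore] -/
theorem _root_.Literature.Probability.RandomPlanarGeometry.JordanDomain.frontier_mulI_carrier :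
    frontier D.mulI.carrier = (fun z => I * z) '' frontier D.carrier :=
  frontier_image_mulI D.carrier

/-- Boundary arcs of `i·D` are the quarter-turned boundary arcs of `D`. [folklore] -/
theorem _root_.Literature.Probability.RandomPlanarGeometry.JordanDomain.mulI_boundary_image (S : Set ℝ) :
    D.mulI.boundary '' S = (fun z => I * z) '' (D.boundary '' S) := by
  rw [Set.image_image]; rfl

/-- **The discrete domain of `i·D` is the quarter-turned discrete domain of `D`**:
`(i·D)_δ = rotCell '' D_δ`. [folklore] -/
theorem meshDomain_mulI_carrier (δ : ℝ) : meshDomain D.mulI.carrier δ = rotCell '' meshDomain D.carrier δ :=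
  meshDomain_mulI D.carrier δ

/-- **The graph `(i·D)^δ` is the push-forward of `D^δ` along `rotCell`.** [folklore] -/
theorem discreteDomainGraph_mulI_carrier (δ : ℝ) :
    discreteDomainGraph D.mulI.carrier δ = (discreteDomainGraph D.carrier δ).map rotCell.toEmbedding :=
  discreteDomainGraph_mulI D.carrier δ

/-- The discrete boundary of `i·D` is the quarter-turned discrete boundary of `D`. [folklore] -/
theorem meshBoundary_mulI_carrier (δ : ℝ) :
    meshBoundary D.mulI.carrier δ = rotCell '' meshBoundary D.carrier δ :=
  meshBoundary_mulI D.carrier δ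

/-- Discrete boundary arcs of `i·D` are the quarter-turned discrete boundary arcs of `D`.
[folklore] -/
theorem discreteArc_mulI_carrier (δ : ℝ) (S : Set ℝ) :
    discreteArc D.mulI.carrier δ (D.mulI.boundary '' S) =
      rotCell '' discreteArc D.carrier δ (D.boundary '' S) := by
  rw [D.mulI_boundary_image]
  exact discreteArc_mulI D.carrier δ _

end JordanDomain

end Literature.Probability.LatticeModels
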